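import Literature.AnabelianGeometry.EtaleTheta.SettingCompletion
import HarnessLib

/-!
# [EtTh] §1 p. 12: the theta quotients `Π^tp_X ↠ (Π^tp_X)^Θ ↠ (Π^tp_X)^ell` of ANY tempered curve record
# (construction over the L3 interface `TemperedCurve p`; the theta-quotient block of `ThetaSetting`)

Mochizuki, *The étale theta function …*, Publ. RIMS **45** (2009) [EtTh], §1, PRIMS PDF p. 12: "we shall
write `Π^tp_X ↠ (Π^tp_X)^Θ ↠ (Π^tp_X)^ell` for the quotients whose kernels are the kernels of the quotients
`Δ^tp_X ↠ (Δ^tp_X)^Θ ↠ (Δ^tp_X)^ell`", themselves "induced by the quotients `Δ_X ↠ Δ^Θ_X :=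
Δ_X/[Δ_X,[Δ_X,Δ_X]] ↠ Δ^ell_X := Δ^ab_X`"; "a natural exact sequence `1 → Δ_Θ → (Δ^tp_X)^Θ → (Δ^tp_X)^ell
→ 1`" with `Δ_Θ` central [cite: MochizukiEtTh2009, §1 p.12].

Layer L2 of the abc-iut cell, prover abc-iut-L2-d1 (gen 4), R78 cluster file F5 (L2-lead RULINGS #13
R100), CARRIER-INDEPENDENT half: a CONSTRUCTION (class (b): new definitions over the frozen interface
`SemiGraphs.TemperedCurve`, no interface clause touched) of the theta-quotient block of the L2 root
`ThetaSetting` (`Setting.lean`, fields `GtpTheta … ker_thetaToEll_central`) for an ARBITRARY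
`X : TemperedCurve p`:

* `thetaKer X := toHat⁻¹([[Δ_X,Δ_X],Δ_X]⁻)`, `ellKer X := toHat⁻¹([Δ_X,Δ_X]⁻)` (normal, by abc-iut-L2-t7's
  `SettingCompletion.deltaHat_normal`), `GTheta X := Π^tp_X/thetaKer`, `GEll X := Π^tp_X/ellKer` with the
  quotient topologies, `toTheta`, `thetaToEll`;
* the eight printed properties as THEOREMS: `continuous_toTheta`, `toTheta_surjective`, `ker_toTheta`,
  `continuous_thetaToEll`, `thetaToEll_surjective`, `ker_toEll`, **`ker_thetaToEll_comm`** (`Δ_Θ` is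
  commutative: `[cl[Δ_X,Δ_X], Δ_X] ⊆ cl[[Δ_X,Δ_X],Δ_X]` by continuity of commutators) and
  **`ker_thetaToEll_central`** (`Δ_Θ` is central in `(Δ^tp_X)^Θ`).

* `augTheta X : (Π^tp_X)^Θ → G_{ℚ_p}` — the augmentation descended to the theta quotient (`thetaKer ≤ Δ^tp_X`):
  `augTheta_toTheta`, `continuous_augTheta`, `range_augTheta` (`= G_K`), `ker_augTheta` (`= (Δ^tp_X)^Θ`),
  `isOpenMap_augTheta` (open when `aug` is) — "the natural surjection `(Π^tp_Y)^ell ↠ G_K`"-type maps, p. 13.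

This is abc-iut-L2-t1's pattern (`SettingModelCurve.KTheta` for the root model `Π^tp_X = F₂ × G_{ℚ_p}`,
`SettingModel2Theta.KTheta₂` for `curve₂`), made uniform in the curve: every curve-based inhabitant of
`ThetaSetting` (the root model, `curve₂`, the χ-twisted model of R78, a genuine tempered `π₁` later) gets
these twelve fields for free.  RELATION TO LAYER L3: `SemiGraphs/TemperedThetaQuotients.lean`
(abc-iut-L3-t2) defines the same quotients over the richer interface `OncePuncturedTemperedGroup K`
(which demands cusp decomposition groups, `ker_augHat`, freeness …) and `ThetaQuotientFacts.lean` proves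
the L2 axioms there; the present file needs ONLY the bare `TemperedCurve` record (no cusps), which is what
the synthetic models carry.  Names mirror L3's (`thetaKer`, `ellKer`).
USAGE NOTE FOR MODEL BUILDERS (instance retrieval): the `Normal` instances `thetaKer_normal X` /
`ellKer_normal X` are keyed on the carrier `TemperedCurve.PiTemp X`; for a CONCRETE model given by a reducible
structure literal (`abbrev curveχ p : TemperedCurve p where …`) the carrier unfolds (e.g. to `Γ ⋊ G_{ℚ_p}`) and
instance search does not find them — re-export them at the model (two lines, cf.
`SettingModelChiLevelKernels.thetaKerχ_normal`), after which `Group` / `IsTopologicalGroup (GTheta (curveχ p))`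
resolve.  The rewriting lemmas `mem_thetaKer_iff` / `mem_ellKer_iff` unfold membership to the `toHat`-image.
HONEST FRAMING: plain topological group theory; nothing of [EtTh] is asserted; no side is taken on
[IUTchIII] Cor. 3.12.
-/

noncomputable section

namespace Literature.AnabelianGeometry.EtaleTheta.CurveTheta

open Literature.AnabelianGeometry.SemiGraphs
open scoped commutatorElement

variable {p : ℕ} [Fact p.Prime] (X : TemperedCurve p)

/-! ### The kernels -/

/-- `Ker(Π^tp_X ↠ (Π^tp_X)^ell) := toHat⁻¹([Δ_X,Δ_X]⁻)` (p. 12). [cite: MochizukiEtTh2009, §1 p.12] -/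
def ellKer : Subgroup X.PiTemp :=
  ((⁅X.DeltaHat, X.DeltaHat⁆).topologicalClosure).comap X.toHat.toMonoidHom

/-- `Ker(Π^tp_X ↠ (Π^tp_X)^Θ) := toHat⁻¹([[Δ_X,Δ_X],Δ_X]⁻)` (p. 12). [cite: MochizukiEtTh2009, §1 p.12] -/
def thetaKer : Subgroup X.PiTemp :=
  ((⁅⁅X.DeltaHat, X.DeltaHat⁆, X.DeltaHat⁆).topologicalClosure).comap X.toHat.toMonoidHom

/-- `toHat⁻¹([Δ_X,Δ_X]⁻)` is normal in `Π^tp_X` (`Δ_X ⊴ Π_X`, abc-iut-L2-t7's `deltaHat_normal`).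
[cite: MochizukiEtTh2009, §1 p.12] -/
instance ellKer_normal : (ellKer X).Normal := by
  haveI := SettingCompletion.deltaHat_normal X
  haveI : ((⁅X.DeltaHat, X.DeltaHat⁆).topologicalClosure).Normal :=
    Subgroup.is_normal_topologicalClosure _
  unfold ellKer
  exact Subgroup.Normal.comap inferInstance _

/-- `toHat⁻¹([[Δ_X,Δ_X],Δ_X]⁻)` is normal in `Π^tp_X`. [cite: MochizukiEtTh2009, §1 p.12] -/
instance thetaKer_normal : (thetaKer X).Normal := by
  haveI := SettingCompletion.deltaHat_normal X
  haveI : ((⁅⁅X.DeltaHat, X.DeltaHat⁆, X.DeltaHat⁆).topologicalClosure).Normal :=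
    Subgroup.is_normal_topologicalClosure _
  unfold thetaKer
  exact Subgroup.Normal.comap inferInstance _

/-- `[[Δ_X,Δ_X],Δ_X] ⊆ [Δ_X,Δ_X]`, hence `thetaKer ≤ ellKer`. [cite: MochizukiEtTh2009, §1 p.12] -/
theorem thetaKer_le_ellKer : thetaKer X ≤ ellKer X := by
  haveI := SettingCompletion.deltaHat_normal X
  refine Subgroup.comap_mono (Subgroup.topologicalClosure_mono ?_)
  exact Subgroup.commutator_mono (Subgroup.commutator_le_left _ _) le_rfl

/-- `ellKer ≤ Δ^tp_X` (abc-iut-L2-t7's `comap_closure_commutator_le_deltaTemp`). [cite: MochizukiEtTh2009, §1 p.12] -/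
theorem ellKer_le_deltaTemp : ellKer X ≤ X.DeltaTemp :=
  SettingCompletion.comap_closure_commutator_le_deltaTemp X

/-- `thetaKer ≤ Δ^tp_X` (abc-iut-L2-t7's `comap_closure_doubleCommutator_le_deltaTemp`).
[cite: MochizukiEtTh2009, §1 p.12] -/
theorem thetaKer_le_deltaTemp : thetaKer X ≤ X.DeltaTemp :=
  SettingCompletion.comap_closure_doubleCommutator_le_deltaTemp X

/-- `[Δ_X,Δ_X]⁻ ≤ Δ_X` (`Δ_X` is closed and normal). [cite: MochizukiEtTh2009, §1 p.12] -/
theorem commutatorClosure_le_deltaHat :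
    (⁅X.DeltaHat, X.DeltaHat⁆).topologicalClosure ≤ X.DeltaHat := by
  haveI := SettingCompletion.deltaHat_normal X
  refine Subgroup.topologicalClosure_minimal _ (Subgroup.commutator_le_left _ _) ?_
  unfold TemperedCurve.DeltaHat
  exact Subgroup.isClosed_topologicalClosure _

/-- `⁅a, b⁆ ∈ cl ⁅A, B⁆` for `a ∈ cl A`, `b ∈ B` (continuity of `x ↦ ⁅x, b⁆`). [folklore] -/
private theorem commutatorElement_mem_closure {G : Type*} [Group G] [TopologicalSpace G]
    [IsTopologicalGroup G] (A B : Subgroup G) {a b : G} (ha : a ∈ A.topologicalClosure) (hb : b ∈ B) :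
    ⁅a, b⁆ ∈ (⁅A, B⁆).topologicalClosure := by
  have hcont : Continuous fun x : G => ⁅x, b⁆ := by
    simp only [commutatorElement_def]
    fun_prop
  have hsub : (A : Set G) ⊆ (fun x : G => ⁅x, b⁆) ⁻¹' ((⁅A, B⁆).topologicalClosure : Set G) :=
    fun x hx => Subgroup.le_topologicalClosure _ (Subgroup.commutator_mem_commutator hx hb)
  have hcl := closure_minimal hsub ((Subgroup.isClosed_topologicalClosure _).preimage hcont)
  have ha' : a ∈ (A.topologicalClosure : Set G) := ha
  rw [Subgroup.topologicalClosure_coe] at ha'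
  exact hcl ha'

/-- For `a ∈ ellKer` and `b` with `toHat b ∈ Δ_X`: `⁅a, b⁆ ∈ thetaKer` — "`Δ_Θ ≅ ∧² Δ^ell_X` is killed in
`Δ^Θ_X` by one more commutator" (p. 12). [cite: MochizukiEtTh2009, §1 p.12] -/
theorem commutatorElement_mem_thetaKer {a b : X.PiTemp} (ha : a ∈ ellKer X)
    (hb : X.toHat b ∈ X.DeltaHat) : ⁅a, b⁆ ∈ thetaKer X := by
  have ha' : X.toHat.toMonoidHom a ∈ (⁅X.DeltaHat, X.DeltaHat⁆).topologicalClosure := ha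
  have hb' : X.toHat.toMonoidHom b ∈ X.DeltaHat := hb
  have key := commutatorElement_mem_closure _ _ ha' hb'
  rw [← map_commutatorElement] at key
  exact key

/-- `toHat b ∈ Δ_X` for `b ∈ ellKer`. [cite: MochizukiEtTh2009, §1 p.12] -/
theorem toHat_mem_deltaHat_of_mem_ellKer {b : X.PiTemp} (hb : b ∈ ellKer X) :
    X.toHat b ∈ X.DeltaHat :=
  commutatorClosure_le_deltaHat X hb

/-- `toHat b ∈ Δ_X` for `b ∈ Δ^tp_X`. [cite: MochizukiEtTh2009, §1 p.12] -/
theorem toHat_mem_deltaHat_of_mem_deltaTemp {b : X.PiTemp} (hb : b ∈ X.DeltaTemp) :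
    X.toHat b ∈ X.DeltaHat :=
  Subgroup.le_topologicalClosure _ ⟨b, hb, rfl⟩

/-! ### The quotients `(Π^tp_X)^Θ`, `(Π^tp_X)^ell` -/

/-- `(Π^tp_X)^Θ := Π^tp_X / toHat⁻¹([[Δ_X,Δ_X],Δ_X]⁻)` with the quotient topology (p. 12).
[cite: MochizukiEtTh2009, §1 p.12] -/
abbrev GTheta : Type := X.PiTemp ⧸ thetaKer X

/-- `(Π^tp_X)^ell := Π^tp_X / toHat⁻¹([Δ_X,Δ_X]⁻)` with the quotient topology (p. 12).
[cite: MochizukiEtTh2009, §1 p.12] -/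
abbrev GEll : Type := X.PiTemp ⧸ ellKer X

/-- `Π^tp_X ↠ (Π^tp_X)^Θ` (p. 12). [cite: MochizukiEtTh2009, §1 p.12] -/
def toTheta : X.PiTemp →* GTheta X := QuotientGroup.mk' (thetaKer X)

/-- `(Π^tp_X)^Θ ↠ (Π^tp_X)^ell` (p. 12). [cite: MochizukiEtTh2009, §1 p.12] -/
def thetaToEll : GTheta X →* GEll X :=
  QuotientGroup.map (thetaKer X) (ellKer X) (MonoidHom.id _)
    (fun x hx => by simpa using thetaKer_le_ellKer X hx)

/-- `(Π^tp_X ↠ (Π^tp_X)^Θ ↠ (Π^tp_X)^ell) = (Π^tp_X ↠ Π^tp_X/ellKer)`. [cite: MochizukiEtTh2009, §1 p.12] -/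
theorem thetaToEll_comp : (thetaToEll X).comp (toTheta X) = QuotientGroup.mk' (ellKer X) := by
  ext x
  rfl

/-- `Π^tp_X ↠ (Π^tp_X)^Θ` is continuous (quotient topology). [cite: MochizukiEtTh2009, §1 p.12] -/
theorem continuous_toTheta : Continuous (toTheta X) := QuotientGroup.continuous_mk

/-- `Π^tp_X ↠ (Π^tp_X)^Θ` is surjective. [cite: MochizukiEtTh2009, §1 p.12] -/
theorem toTheta_surjective : Function.Surjective (toTheta X) := QuotientGroup.mk'_surjective _

/-- `Ker(Π^tp_X ↠ (Π^tp_X)^Θ) = toHat⁻¹([[Δ_X,Δ_X],Δ_X]⁻)` — the root field `ker_toTheta`, by construction.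
[cite: MochizukiEtTh2009, §1 p.12] -/
theorem ker_toTheta : (toTheta X).ker =
    ((⁅⁅X.DeltaHat, X.DeltaHat⁆, X.DeltaHat⁆).topologicalClosure).comap X.toHat.toMonoidHom :=
  QuotientGroup.ker_mk' _

/-- `(Π^tp_X)^Θ ↠ (Π^tp_X)^ell` is continuous (both quotient topologies; `Π^tp_X ↠ (Π^tp_X)^Θ` is a
quotient map). [cite: MochizukiEtTh2009, §1 p.12] -/
theorem continuous_thetaToEll : Continuous (thetaToEll X) := by
  rw [(QuotientGroup.isQuotientMap_mk (thetaKer X)).continuous_iff]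
  change Continuous ((thetaToEll X).comp (toTheta X))
  rw [thetaToEll_comp]
  exact QuotientGroup.continuous_mk

/-- `(Π^tp_X)^Θ ↠ (Π^tp_X)^ell` is surjective. [cite: MochizukiEtTh2009, §1 p.12] -/
theorem thetaToEll_surjective : Function.Surjective (thetaToEll X) := by
  intro y
  obtain ⟨b, rfl⟩ := QuotientGroup.mk_surjective y
  exact ⟨(b : GTheta X), rfl⟩

/-- `Ker(Π^tp_X ↠ (Π^tp_X)^ell) = toHat⁻¹([Δ_X,Δ_X]⁻)` — the root field `ker_toEll`, by construction.
[cite: MochizukiEtTh2009, §1 p.12] -/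
theorem ker_toEll : ((thetaToEll X).comp (toTheta X)).ker =
    ((⁅X.DeltaHat, X.DeltaHat⁆).topologicalClosure).comap X.toHat.toMonoidHom := by
  rw [thetaToEll_comp]
  exact QuotientGroup.ker_mk' _

/-- Membership in `Δ_Θ = Ker((Π^tp_X)^Θ ↠ (Π^tp_X)^ell)` is read on representatives.
[cite: MochizukiEtTh2009, §1 p.12] -/
theorem mk_mem_ker_thetaToEll_iff (x : X.PiTemp) :
    toTheta X x ∈ (thetaToEll X).ker ↔ x ∈ ellKer X := by
  rw [MonoidHom.mem_ker, ← MonoidHom.comp_apply, thetaToEll_comp, QuotientGroup.mk'_apply,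
    QuotientGroup.eq_one_iff]

/-- `a·b·(b·a)⁻¹ = ⁅a, b⁆`. [folklore] -/
private theorem mul_div_mul_comm_eq {G : Type*} [Group G] (a b : G) : a * b / (b * a) = ⁅a, b⁆ := by
  rw [commutatorElement_def, div_eq_mul_inv, mul_inv_rev, ← mul_assoc]

/-- **`Δ_Θ = Ker((Π^tp_X)^Θ ↠ (Π^tp_X)^ell)` is commutative** — the root field `ker_thetaToEll_comm`
("`Δ_Θ (≅ Ẑ(1))`", p. 12): for `a, b ∈ ellKer`, `⁅a, b⁆ ∈ thetaKer` by continuity of commutators.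
[cite: MochizukiEtTh2009, §1 p.12] -/
theorem ker_thetaToEll_comm :
    ∀ x ∈ (thetaToEll X).ker, ∀ y ∈ (thetaToEll X).ker, x * y = y * x := by
  intro x hx y hy
  obtain ⟨a, rfl⟩ := QuotientGroup.mk_surjective x
  obtain ⟨b, rfl⟩ := QuotientGroup.mk_surjective y
  have ha : a ∈ ellKer X := (mk_mem_ker_thetaToEll_iff X a).mp hx
  have hb : b ∈ ellKer X := (mk_mem_ker_thetaToEll_iff X b).mp hy
  rw [← QuotientGroup.mk_mul, ← QuotientGroup.mk_mul, QuotientGroup.eq_iff_div_mem,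
    mul_div_mul_comm_eq]
  exact commutatorElement_mem_thetaKer X ha (toHat_mem_deltaHat_of_mem_ellKer X hb)

/-- **`Δ_Θ` is central in `(Δ^tp_X)^Θ`** — the root field `ker_thetaToEll_central` ("`Δ^Θ_X` is a central
extension", p. 12): for `a ∈ ellKer` and `c ∈ Δ^tp_X`, `⁅a, c⁆ ∈ thetaKer`. [cite: MochizukiEtTh2009, §1 p.12] -/
theorem ker_thetaToEll_central :
    ∀ x ∈ (thetaToEll X).ker, ∀ y ∈ (X.aug.toMonoidHom.ker).map (toTheta X), x * y = y * x := by
  intro x hx y hy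
  obtain ⟨a, rfl⟩ := QuotientGroup.mk_surjective x
  obtain ⟨c, hc, rfl⟩ := hy
  have ha : a ∈ ellKer X := (mk_mem_ker_thetaToEll_iff X a).mp hx
  show (a : GTheta X) * (c : GTheta X) = (c : GTheta X) * (a : GTheta X)
  rw [← QuotientGroup.mk_mul, ← QuotientGroup.mk_mul, QuotientGroup.eq_iff_div_mem,
    mul_div_mul_comm_eq]
  exact commutatorElement_mem_thetaKer X ha (toHat_mem_deltaHat_of_mem_deltaTemp X hc)

/-- The image of `Δ^tp_X` in `(Π^tp_X)^Θ` lies in the kernel of the induced augmentation: `thetaKer ≤ Δ^tp_X`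
lets `aug` descend to `(Π^tp_X)^Θ` (used by model builders for `(Π^tp_X)^Θ ↠ G_K`).
[cite: MochizukiEtTh2009, §1 p.12] -/
theorem thetaKer_le_ker_aug : thetaKer X ≤ X.aug.toMonoidHom.ker := thetaKer_le_deltaTemp X

/-! ### The augmentation of `(Π^tp_X)^Θ` -/

/-- **`(Π^tp_X)^Θ → G_{ℚ_p}`**, the augmentation `aug : Π^tp_X → G_{ℚ_p}` descended to the theta quotient
(`Ker(Π^tp_X ↠ (Π^tp_X)^Θ) ⊆ Δ^tp_X = Ker aug`, p. 12; cf. "the natural surjection `(Π^tp_Y)^ell ↠ G_K`", p. 13).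
[cite: MochizukiEtTh2009, §1 p.12] -/
def augTheta : GTheta X →* GQp p :=
  QuotientGroup.lift (thetaKer X) X.aug.toMonoidHom (thetaKer_le_ker_aug X)

/-- `augTheta ∘ toTheta = aug` on elements. [cite: MochizukiEtTh2009, §1 p.12] -/
@[simp] theorem augTheta_toTheta (g : X.PiTemp) : augTheta X (toTheta X g) = X.aug g := rfl

/-- `augTheta ∘ toTheta = aug`. [cite: MochizukiEtTh2009, §1 p.12] -/
theorem augTheta_comp_toTheta : (augTheta X).comp (toTheta X) = X.aug.toMonoidHom := by
  ext g
  rfl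

/-- `augTheta` is continuous (`toTheta` is a topological quotient map and `aug` is continuous).
[cite: MochizukiEtTh2009, §1 p.12] -/
theorem continuous_augTheta : Continuous (augTheta X) := by
  rw [(QuotientGroup.isQuotientMap_mk (thetaKer X)).continuous_iff]
  exact X.aug.continuous

/-- The image of `augTheta` is the image of `aug`. [cite: MochizukiEtTh2009, §1 p.12] -/
theorem range_augTheta : (augTheta X).range = X.aug.toMonoidHom.range := by
  rw [← augTheta_comp_toTheta, MonoidHom.range_comp, MonoidHom.range_eq_top.mpr (toTheta_surjective X),
    ← MonoidHom.range_eq_map]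

/-- … namely `G_K` (the interface field `range_aug`). [cite: MochizukiEtTh2009, §1 p.12] -/
theorem range_augTheta_eq_fixingSubgroup : (augTheta X).range = X.K.fixingSubgroup := by
  rw [range_augTheta, X.range_aug]

/-- `Ker(augTheta) = (Δ^tp_X)^Θ`, the image of `Δ^tp_X = Ker aug` in `(Π^tp_X)^Θ`. [cite: MochizukiEtTh2009, §1 p.12] -/
theorem ker_augTheta : (augTheta X).ker = X.DeltaTemp.map (toTheta X) := by
  ext x
  obtain ⟨g, rfl⟩ := QuotientGroup.mk_surjective x
  constructor
  · intro hx
    exact ⟨g, hx, rfl⟩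
  · rintro ⟨g', hg', hgg'⟩
    rw [MonoidHom.mem_ker, ← hgg']
    exact hg'

/-- If `aug` is an open map, so is `augTheta` (`toTheta` is surjective and continuous): the case of a model
whose Galois factor carries the Krull topology. [cite: MochizukiEtTh2009, §1 p.12] -/
theorem isOpenMap_augTheta (h : IsOpenMap X.aug) : IsOpenMap (augTheta X) := by
  intro U hU
  have hpre : IsOpen ((toTheta X) ⁻¹' U) := (continuous_toTheta X).isOpen_preimage U hU
  have himg : augTheta X '' U = X.aug '' ((toTheta X) ⁻¹' U) := by
    ext σ
    constructor
    · rintro ⟨x, hx, rfl⟩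
      obtain ⟨g, rfl⟩ := toTheta_surjective X x
      exact ⟨g, hx, rfl⟩
    · rintro ⟨g, hg, rfl⟩
      exact ⟨toTheta X g, hg, rfl⟩
  rw [himg]
  exact h _ hpre

/-! ### Membership unfolding (for model files) -/

/-- `g ∈ thetaKer X ↔ toHat g ∈ [[Δ_X,Δ_X],Δ_X]⁻` (definitional unfolding, as a rewriting lemma).
[cite: MochizukiEtTh2009, §1 p.12] -/
theorem mem_thetaKer_iff (g : X.PiTemp) :
    g ∈ thetaKer X ↔ X.toHat g ∈ (⁅⁅X.DeltaHat, X.DeltaHat⁆, X.DeltaHat⁆).topologicalClosure := Iff.rfl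

/-- `g ∈ ellKer X ↔ toHat g ∈ [Δ_X,Δ_X]⁻`. [cite: MochizukiEtTh2009, §1 p.12] -/
theorem mem_ellKer_iff (g : X.PiTemp) :
    g ∈ ellKer X ↔ X.toHat g ∈ (⁅X.DeltaHat, X.DeltaHat⁆).topologicalClosure := Iff.rfl

/-- `toTheta g ∈ Ker(thetaToEll) ↔ g ∈ ellKer` restated with `Δ_Θ := Ker(thetaToEll)` membership on the left and the
`toHat`-image on the right (the form model files rewrite with). [cite: MochizukiEtTh2009, §1 p.12] -/
theorem toTheta_mem_ker_thetaToEll_iff (g : X.PiTemp) :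
    toTheta X g ∈ (thetaToEll X).ker ↔ X.toHat g ∈ (⁅X.DeltaHat, X.DeltaHat⁆).topologicalClosure :=
  mk_mem_ker_thetaToEll_iff X g

/-- Every element of `Δ_Θ = Ker(thetaToEll)` is `toTheta g` for some `g ∈ ellKer` (surjectivity of `toTheta`).
[cite: MochizukiEtTh2009, §1 p.12] -/
theorem exists_eq_toTheta_of_mem_ker_thetaToEll {x : GTheta X} (hx : x ∈ (thetaToEll X).ker) :
    ∃ g ∈ ellKer X, toTheta X g = x := by
  obtain ⟨g, rfl⟩ := toTheta_surjective X x
  exact ⟨g, (mk_mem_ker_thetaToEll_iff X g).mp hx, rfl⟩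

end Literature.AnabelianGeometry.EtaleTheta.CurveTheta

end
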